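import Literature.Probability.LatticeModels.DirichletGreenFunction
import Literature.Probability.RandomPlanarGeometry.ConformalMap
import HarnessLib

/-!
# Kozdron–Lawler: uniform asymptotics of the excursion Poisson kernel and of the boundary Green
# function of simply connected subsets of `ℤ²`

Topic `Literature/Probability/LatticeModels`; companion of `DirichletGreenFunction.lean`
(`dirichletGreen`, `poissonKernel`). Two NAMED FACTS (statements only, nothing asserted) from
M. J. Kozdron, G. F. Lawler, *Estimates of random walk exit probabilities and application to
loop-erased random walk*, Electron. J. Probab. 10 (2005), arXiv:math/0501189 (`KozdronLawler2005`):

* `KozdronLawler_excursionPoissonKernel` — Theorem 1.1: for `A ∈ 𝒜ⁿ` (finite, `A` and `ℤ² ∖ A`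
  nearest-neighbour connected, `n ≤ inrad(A) ≤ 2n`) the excursion Poisson kernel factorises,
  `h_{∂A}(x,y) = (π/2) h_A(0,x) h_A(0,y) / (1 - cos(θ_A(x) - θ_A(y))) · [1 + O(log n /(n^{1/16}|Δθ|))]`
  uniformly in `A`, for `|Δθ| ≥ n^{-1/16} log² n` — "local × local × conformally invariant";
* `KozdronLawler_greenFunctionBoundary` — Proposition 3.10, eq. (3.21): the same factorisation for
  the random-walk Green function `G_A(x,y)` at two points of `A` near the boundary
  (`x, y ∉ A^{*,n} = {g_A ≥ n^{-1/16}}`), with `G_A(x) = G_A(0,x)`.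

Dictionary (paper ↔ tree, `A ⊆ ℤ²` finite): `h_A(x,y)` (`x ∈ A`, `y ∈ ∂A`: probability that SRW from
`x` leaves `A` at `y`; Def. 2.17) = `poissonKernel A x y` (`= ∑_{w ∼ y} dirichletGreen A x w`,
`sum_poissonKernel = 1`); `h_{∂A}(x,y) = (1/4) ∑_{(z,x) ∈ ∂_e A} h_A(z,y)` (Def. 2.18) =
`(1/4) * ∑ z ∈ (zdGraph 2).neighborFinset x, poissonKernel A z y` (`poissonKernel A z y = 0` for
`z ∉ A`); Lawler's Green function `G_A(x,y)` (expected number of visits) `= 4 · dirichletGreen A x y`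
(tree normalisation `dirichletGreen = (4·1 - A_Λ)⁻¹`); "simply connected subset of `ℤ²`" (§2.1) =
connectedness of the graphs induced by `zdGraph 2` on `↑A` and on `(↑A)ᶜ`;
`inrad(A) = min{|z| : z ∈ ℤ² ∖ A}`, `𝒜ⁿ = {n ≤ inrad(A) ≤ 2n}`; the union-of-squares domain `Ã`
(§2.1; for simply connected `A` the interior of `⋃_{x ∈ A} (x + [-1/2,1/2]²)`) and its Riemann map
`f_A : Ã → 𝔻`, `f_A(0) = 0`, `f_A'(0) > 0` = a tree `ConformalEquiv Ã (ball 0 1)` so normalised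
(`existsUnique_conformalEquiv_ball`, `ConformalMap.lean`); `θ_A(x) = arg f_A(x)` on `A`, extended to
`z ∈ ∂A` as the average of `θ_A` over the inner neighbours of `z` (§2.5, before (2.19):
`θ_A(z) = θ_A(x) + O(n^{-1/2})` for `(x,z) ∈ ∂_e A`).

Design choices. To avoid `arg` (branch cut) and the average, the statements use, for boundary
vertices, ANY inner neighbour `x' ∼ x`, `y' ∼ y` and the unit vectors `e_x = f_A(x')/|f_A(x')|`,
`e_y = f_A(y')/|f_A(y')|`, with `1 - cos(θ_A(x) - θ_A(y)) = |e_x - e_y|²/2` and the chord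
`|e_x - e_y| ∈ [(2/π)|Δθ|, |Δθ|]` in place of `|θ_A(x) - θ_A(y)|`; by the cited `O(n^{-1/2})`
comparison these forms FOLLOW from the printed ones (the threshold `2 n^{-1/16} log² n` on the chord
gives the paper's `|Δθ| ≥ n^{-1/16} log² n` for `n ≥ n₀`, and the relative change
`O(n^{-1/2}/|Δθ|)` of the global factor is dominated by the error term `log n /(n^{1/16} |Δθ|)`),
with a different constant `c` and an `n₀` — both existentially quantified, as the paper's `O(·)` is.
`-- TODO(general form):` the paper's `k`-fold determinant version (Thm 1.3) and the interior form of
Prop. 3.10 (`y ∈ A^{*,n}`, eq. (3.20)) are not transcribed.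

Why here: the line `excursion-kernel-covariance` for Cardy's formula on bond-`ℤ²`
(crux `RectilinearCardy`, stmt-CriticalPhenomena-5660, route `CardyBoundaryCoulombGas`) reads the law
of the `d`-most boundary vertex joined to an arc against the cube root of a product of three
`dirichletGreen` kernels of the lattice polygon; its stub `stub_kernelScalingLimit` (a)(c)(d) is
blocked exactly on `KozdronLawler_greenFunctionBoundary` (+ weak convergence of discrete harmonic
measure). Statements transcribed from the held text (`lit read arxiv:math/0501189`, pp. 3, 8, 12–13)
by the line lead's stub worker; NOT proved here.
-/

noncomputable section

namespace Literature.Probability.LatticeModels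

open Literature.Probability.RandomPlanarGeometry

/-- **Kozdron–Lawler, Theorem 1.1 (uniform factorisation of the discrete excursion Poisson kernel
of simply connected subsets of `ℤ²`).** There are `c < ∞` and `n₀` such that for every `n ≥ n₀`,
every finite `A ⊆ ℤ²` with `A` and `ℤ² ∖ A` nearest-neighbour connected and
`n ≤ inrad(A) ≤ 2n`, every Riemann map `φ` of the union-of-squares domain `Ã` onto the unit disc
with `φ 0 = 0`, `φ'(0) > 0`, and all outer-boundary vertices `x, y` of `A` with inner neighbours
`x', y'`, writing `e_x = φ(x')/|φ(x')|`, `e_y = φ(y')/|φ(y')|` and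
`main = π · h_A(0,x) · h_A(0,y) / |e_x - e_y|²`
(`= (π/2) h_A(0,x) h_A(0,y) / (1 - cos(θ_A(x) - θ_A(y)))`): if `|e_x - e_y| ≥ 2 n^{-1/16} log² n`
then `|h_{∂A}(x,y) - main| ≤ c · main · log n / (n^{1/16} |e_x - e_y|)` — "excursion Poisson
kernel = local part `h_A(0,x) h_A(0,y)` × conformally invariant global part, uniformly over all
simply connected domains, with a power-law error in the inradius".
[cite: KozdronLawler2005, Thm 1.1] -/
def KozdronLawler_excursionPoissonKernel : Prop :=
  ∃ c : ℝ, ∃ n₀ : ℕ, ∀ n : ℕ, n₀ ≤ n → ∀ A : Finset (Site 2),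
    ((zdGraph 2).induce (↑A : Set (Site 2))).Connected →
    ((zdGraph 2).induce (↑A : Set (Site 2))ᶜ).Connected →
    (∀ z : Site 2, z ∉ A → (n : ℝ) ≤ ‖Site.toComplex z‖) →
    (∃ z : Site 2, z ∉ A ∧ ‖Site.toComplex z‖ ≤ 2 * n) →
    ∀ φ : ConformalEquiv
        (interior (⋃ x ∈ A, {w : ℂ | |w.re - (x 0 : ℝ)| ≤ 1 / 2 ∧ |w.im - (x 1 : ℝ)| ≤ 1 / 2}))
        (Metric.ball (0 : ℂ) 1),
      φ 0 = 0 → 0 < (deriv φ 0).re → (deriv φ 0).im = 0 →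
    ∀ x y x' y' : Site 2, x ∉ A → y ∉ A → x' ∈ A → y' ∈ A →
      (zdGraph 2).Adj x x' → (zdGraph 2).Adj y y' →
      2 * (n : ℝ) ^ (-(1 / 16 : ℝ)) * Real.log n ^ 2 ≤
          ‖φ (Site.toComplex x') / (‖φ (Site.toComplex x')‖ : ℂ) -
            φ (Site.toComplex y') / (‖φ (Site.toComplex y')‖ : ℂ)‖ →
      |(1 / 4 : ℝ) * ∑ z ∈ (zdGraph 2).neighborFinset x, poissonKernel A z y -
          Real.pi * poissonKernel A 0 x * poissonKernel A 0 y /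
            ‖φ (Site.toComplex x') / (‖φ (Site.toComplex x')‖ : ℂ) -
              φ (Site.toComplex y') / (‖φ (Site.toComplex y')‖ : ℂ)‖ ^ 2| ≤
        c * (Real.pi * poissonKernel A 0 x * poissonKernel A 0 y /
            ‖φ (Site.toComplex x') / (‖φ (Site.toComplex x')‖ : ℂ) -
              φ (Site.toComplex y') / (‖φ (Site.toComplex y')‖ : ℂ)‖ ^ 2) *
          Real.log n / ((n : ℝ) ^ (1 / 16 : ℝ) *
            ‖φ (Site.toComplex x') / (‖φ (Site.toComplex x')‖ : ℂ) -
              φ (Site.toComplex y') / (‖φ (Site.toComplex y')‖ : ℂ)‖)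

/-- **Green-function form (Kozdron–Lawler, Prop. 3.10, eq. (3.21)) — the form the line actually
consumes** (`excursionKernel = dirichletGreen Ω_δ` at two boundary-row vertices): for `A ∈ 𝒜ⁿ`,
`x, y ∈ A` both OUTSIDE the bulk `A^{*,n} = {z ∈ A : g_A(z) ≥ n^{-1/16}}` and
`|θ_A(x) - θ_A(y)| ≥ n^{-1/16} log² n`,
`G_A(x,y) = (π/2) G_A(x) G_A(y) / (1 - cos(θ_A(x) - θ_A(y))) · [1 + O(n^{-1/16} log n / |θ_A(x) - θ_A(y)|)]`
with `G_A(x) = G_A(0,x)` Lawler's Green function `= 4 · dirichletGreen A 0 x` (tree normalisation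
`dirichletGreen = (4·1 - A_Λ)⁻¹`). Stated with the chord `|e_x - e_y|`, `e = φ/|φ|`, as above, and
with the near-boundary condition `|φ(x)|, |φ(y)| > exp(-n^{-1/16})` (`x, y ∉ A^{*,n}`, `|f_A| = e^{-g_A}`,
eq. (2.8)); the chord threshold `2 n^{-1/16} log² n` implies the paper's `y ∈ J_{x,n}`
(`|f_A(y) - e^{iθ_A(x)}| ≥ |e_y - e_x| - (1 - |f_A(y)|) ≥ n^{-1/16} log² n` for `n ≥ 3`).
[cite: KozdronLawler2005, Prop. 3.10] -/
def KozdronLawler_greenFunctionBoundary : Prop :=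
  ∃ c : ℝ, ∃ n₀ : ℕ, ∀ n : ℕ, n₀ ≤ n → ∀ A : Finset (Site 2),
    ((zdGraph 2).induce (↑A : Set (Site 2))).Connected →
    ((zdGraph 2).induce (↑A : Set (Site 2))ᶜ).Connected →
    (∀ z : Site 2, z ∉ A → (n : ℝ) ≤ ‖Site.toComplex z‖) →
    (∃ z : Site 2, z ∉ A ∧ ‖Site.toComplex z‖ ≤ 2 * n) →
    ∀ φ : ConformalEquiv
        (interior (⋃ x ∈ A, {w : ℂ | |w.re - (x 0 : ℝ)| ≤ 1 / 2 ∧ |w.im - (x 1 : ℝ)| ≤ 1 / 2}))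
        (Metric.ball (0 : ℂ) 1),
      φ 0 = 0 → 0 < (deriv φ 0).re → (deriv φ 0).im = 0 →
    ∀ x y : Site 2, x ∈ A → y ∈ A →
      Real.exp (-(n : ℝ) ^ (-(1 / 16 : ℝ))) < ‖φ (Site.toComplex x)‖ →
      Real.exp (-(n : ℝ) ^ (-(1 / 16 : ℝ))) < ‖φ (Site.toComplex y)‖ →
      2 * (n : ℝ) ^ (-(1 / 16 : ℝ)) * Real.log n ^ 2 ≤
          ‖φ (Site.toComplex x) / (‖φ (Site.toComplex x)‖ : ℂ) -
            φ (Site.toComplex y) / (‖φ (Site.toComplex y)‖ : ℂ)‖ →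
      |4 * dirichletGreen A x y -
          Real.pi * (4 * dirichletGreen A 0 x) * (4 * dirichletGreen A 0 y) /
            ‖φ (Site.toComplex x) / (‖φ (Site.toComplex x)‖ : ℂ) -
              φ (Site.toComplex y) / (‖φ (Site.toComplex y)‖ : ℂ)‖ ^ 2| ≤
        c * (Real.pi * (4 * dirichletGreen A 0 x) * (4 * dirichletGreen A 0 y) /
            ‖φ (Site.toComplex x) / (‖φ (Site.toComplex x)‖ : ℂ) -
              φ (Site.toComplex y) / (‖φ (Site.toComplex y)‖ : ℂ)‖ ^ 2) *
          Real.log n / ((n : ℝ) ^ (1 / 16 : ℝ) *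
            ‖φ (Site.toComplex x) / (‖φ (Site.toComplex x)‖ : ℂ) -
              φ (Site.toComplex y) / (‖φ (Site.toComplex y)‖ : ℂ)‖)

end Literature.Probability.LatticeModels
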